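import Summits.BirchSwinnertonDyer.BirchSwinnertonDyer.Theorems.PrintCFramBottomClassIndexLawFiveLeFlipRungAllInstances
import Summits.BirchSwinnertonDyer.BirchSwinnertonDyer.Theorems.PrintCFramBottomClassIndexLawFiveLeFlipRungLowerUnipotentOfFacts
import Summits.BirchSwinnertonDyer.BirchSwinnertonDyer.Theorems.PrintCFramBottomClassIndexLawFiveLeFlipRungTwoOfFactsFour
import Summits.BirchSwinnertonDyer.BirchSwinnertonDyer.Theorems.PrintCFramBottomClassIndexLawFiveLeFlipRungTwoEightModularAssembly
import Summits.BirchSwinnertonDyer.BirchSwinnertonDyer.Theorems.PrintCFramBottomClassIndexLawFiveLeCuspCutFormOfFacts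
import HarnessLib

/-!
# Crux `PrintCFram.BottomClassIndexLawFiveLe` (stmt-BirchSwinnertonDyer-20372): THE CURVE-FREE SEED SUPPLY T_A OF THE PUBLISHED LINE
# `legendre_half_transfer` IS PRINT — (SeedAwayFromP⁶) ⟸ NF-A (Cohen 1975 Thm 3.1) ∧ NF-Q (Katz 1973 Cor. 1.6.2)
# (cell `bsd-print-cfram`, width seat `bsd-line-cfram-p1-w7` g13; THEOREMS ONLY, `--supports` 20372; BSD is not proved by any of this)

HONEST FRAMING. Nothing here is a statement about BSD; no registered stub of the line of record (`eisenstein-resource-bdp-line`, registry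
v31/v32) is closed by this file, and the crux stays OPEN (its residue is the arithmetic B1 pair). What this file settles, MODULO PRINT and BY
NAME, are the two NEW analytic stubs of the publish-only line `Cruxes/BottomClassIndexLawFiveLe/Lines/legendre_half_transfer.lean` (ideator
`bsd-idea-7` g14/g15, critic V#131): `stub_seedAwayFromP_offD` (card label «DEVICE-M») and `stub_seedAwayFromP_onD` (card label «RESEARCH-S —
no device in hand, statement not in print … the KNOWN FRONTIER of the half-integral-weight method»), i.e. the curve-free seed supply

  T_A = (SeedAwayFromP⁶): for each leaf prime `p ∈ {7, 11, 19, 43, 67, 163}`, each primitive quadratic `χ` mod `m ⊥ p`, each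
  `k ∈ {(p+1)/4, (3p−1)/4}` with `2 ≤ k ≤ p − 2` and `χ(−1)(−1)^k = −1`, and a UNIT class factor `B_{p−k,χ}/(p−k)`, SOME imaginary
  quadratic `K₀` with EVERY prime `q ∣ m` split, `d_{K₀}` odd `< −4`, a Kronecker character `ε₀` of `K₀`, and a `p`-adic UNIT field
  factor `B_{k,(χ ε₀)~}/k` (nothing is asked at `p`),

as a KERNEL consequence of the two refereed facts already cited by the line of record's `stub_printsCohenKatzCusps`: NF-A
`Cohen1975.thm31_cohenSeries_mem_halfIntModularForms` and NF-Q `Katz1973_qExpansionPrinciple_allCusps` (hypothesis-taking form, the cell's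
`…_of_facts` convention). THE PROOF IS AN ASSEMBLY of theorems this cell landed for the line of record, by a three-way split of the class datum:
* OFF `D_p` (no prime `ℓ ∣ m` with `ℓ ≡ ±1 (mod p)`): the EISENSTEIN CUSP SEED `CuspGlue.cuspSeed_six_of_facts` (w8 g8 / w5 g5, (CuspSeed⁶) from
  NF-A ∧ NF-Q) — whose statement is `stub_seedAwayFromP_offD` with the regularity binder IDLE: off `D_p` no unit class factor is needed;
* ON `D_p`, GENUS-INTERNAL pattern (every odd `q ∣ m` has `(−p/q) = +1`, and `p ≡ 7 (mod 8)` if `2 ∣ m`): the CM field `K₀ = ℚ(√−p)` ITSELF is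
  `m`-admissible, and its field factor is the REFLECTED class factor (`FlipRung.exists_cmField_fieldFactor_le_imp`, LEAD g14), a unit by
  regularity — FACT-FREE (`seed_cmField_of_genusInternal` below);
* ON `D_p`, OFF the genus-internal pattern: LEAD g14's no-exception glue `FlipRung.seedOffExc_of_flipRungAll_of_flipRungTwo` (p713824) fed by
  the two flipped-cusp rungs FROM THE FACTS — (FlipRungAll⁶) = `FlipRung.flipRungAll_six_of_facts` (w3 g19 p720926: Raum 2023 Prop. 2.3's lower
  unipotent with Kloosterman weights) and (FlipRungTwo⁶) = `FlipRung.flipRungTwo_six_of_facts_of_jmlTwoEight` ∘ `FlipRung.jmlTwoEight_six_of_facts`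
  (w6 g10 p718171 ∘ w8 g10 p718821, the 2-adic rung).
So the legendre line's analytic content reduces to its T_B (`stub_legendreHalfTransfer`) on the genus-internal pattern — the transfer of a unit
field factor from `ℚ(√−p)` to a field in which `p` splits — a statement the line of record never needs (its END STATE asks for an admissible
seed only OFF the genus-internal pattern, binder `hoff` of the exc slot, and sends the genus-internal classes through the routing / identity road
of registries v26–v31) and does not prove; T_A itself needs neither that routing nor Kriz–Li. No definitions, no named facts, no `sorry`;
beyond-print theorem: NO (print modulo NF-A ∧ NF-Q). BSD is not proved by any of this; no summit statement is proved by this seat.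
References: [Cohen1975] Thm. 3.1; [Katz1973] Cor. 1.6.2; [Raum2023RamanujanTypeII] Prop. 2.3, Lemma 2.4; [Washington1997] Thm. 5.11 (Kummer's
congruence behind the reflection); the legendre line card `Lines/legendre-half-transfer.md` and `Lines/legendre-half-transfer-P4.md` §F.
-/

set_option autoImplicit false
-- summit-side namespace `Summit.BirchSwinnertonDyer.BirchSwinnertonDyer.…` (single-conjunct summit, D-0017 layout)
set_option linter.dupNamespace false

noncomputable section

open scoped Classical NumberTheorySymbols
open NumberField DirichletCharacter Literature.NumberTheory.LFunctions
  Literature.NumberTheory.EllipticCurves Literature.NumberTheory.EllipticCurves.KrizLi2019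
  Literature.NumberTheory.QuadraticFields

namespace Summit.BirchSwinnertonDyer.BirchSwinnertonDyer.Theorems.PrintCFram.SeedAwayFromP

open Summit.BirchSwinnertonDyer.BirchSwinnertonDyer.Theorems.PrintCFram

variable {p : ℕ} [hp : Fact p.Prime]

/-! ## §1 The genus-internal pattern: the CM field is its own seed (fact-free) -/

/-- **On the genus-internal pattern the CM field `ℚ(√−p)` is an `m`-admissible unit seed (no printed fact needed).** If every odd prime
`q ∣ m` has `(−p/q) = +1` and `p ≡ 7 (mod 8)` whenever `2 ∣ m`, then every prime of `m` splits in `K₀ = ℚ(√−p)` (`d_{K₀} = −p` is odd and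
`< −4` at the six leaf primes), and for a Kronecker character `ε₀` of `K₀` the field factor `B_{k,(χε₀)~}/k` is a `p`-adic unit as soon as
the class factor `B_{p−k,χ}/(p−k)` is — the contrapositive of LEAD g14's reflection `FlipRung.exists_cmField_fieldFactor_le_imp` (Kummer's
congruence + the factorisation of the twisted Bernoulli number). [cite: Washington1997, Thm. 5.11] [folklore] -/
theorem seed_cmField_of_genusInternal (hp6 : p = 7 ∨ p = 11 ∨ p = 19 ∨ p = 43 ∨ p = 67 ∨ p = 163) (m : ℕ) [NeZero m]
    (χ : DirichletCharacter ℚ_[p] m) (k : ℕ) (hmp : m.Coprime p) (hχ : χ.IsPrimitive)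
    (hk : k = (p + 1) / 4 ∨ k = (3 * p - 1) / 4)
    (hGI : (∀ q : ℕ, q.Prime → q ∣ m → q ≠ 2 → jacobiSym (-(p : ℤ)) q = 1) ∧ (2 ∣ m → p % 8 = 7))
    (hreg : ¬ ‖((p - k : ℕ) : ℚ_[p])⁻¹ * generalizedBernoulli (p - k) χ‖ ≤ (p : ℝ)⁻¹) :
    ∃ (K : Type) (_ : Field K) (_ : NumberField K) (εK : DirichletCharacter ℚ_[p] (NumberField.discr K).natAbs),
      IsImaginaryQuadratic K ∧
      (∀ q : ℕ, q.Prime → q ∣ m → ((Ideal.span {(q : ℤ)}).primesOver (𝓞 K)).ncard = 2) ∧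
      Odd (NumberField.discr K) ∧ NumberField.discr K < -4 ∧ IsKroneckerCharacterOf K εK ∧
      ¬ ‖(k : ℚ_[p])⁻¹ * @generalizedBernoulli ℚ_[p] _ _
          (changeLevel (dvd_mul_right m (NumberField.discr K).natAbs) χ *
            changeLevel (dvd_mul_left (NumberField.discr K).natAbs m) εK).conductor ⟨conductor_ne_zero _⟩ k
          (changeLevel (dvd_mul_right m (NumberField.discr K).natAbs) χ *
            changeLevel (dvd_mul_left (NumberField.discr K).natAbs m) εK).primitiveCharacter‖ ≤ (p : ℝ)⁻¹ := by
  have hpp : p.Prime := hp.out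
  have h7 : 7 ≤ p := by rcases hp6 with h | h | h | h | h | h <;> omega
  have hp2 : p ≠ 2 := by omega
  obtain ⟨K₀, iF, iN, ε₀, hK, hd, hε, himp⟩ := FlipRung.exists_cmField_fieldFactor_le_imp hp6 m χ k hmp hχ hk
  refine ⟨K₀, iF, iN, ε₀, hK, ?_, ?_, ?_, hε, fun h => hreg (himp h)⟩
  · intro q hq hqm
    by_cases hq2 : q = 2
    · subst hq2
      have h8 : NumberField.discr K₀ % 8 = 1 := by
        rw [hd]
        have := hGI.2 hqm
        omega
      have h := (Quadratic.ncard_primesOver_two_eq_two_iff hK.1).mpr h8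
      simpa using h
    · rw [Quadratic.ncard_primesOver_eq_two_iff_jacobiSym hK.1 hq hq2, hd]
      exact hGI.1 q hq hqm hq2
  · rw [hd]
    exact (Int.odd_coe_nat p |>.mpr (hpp.eq_two_or_odd'.resolve_left hp2)).neg
  · rw [hd]
    omega

/-! ## §2 T_A = (SeedAwayFromP⁶) from NF-A ∧ NF-Q -/

/-- **T_A = (SeedAwayFromP⁶) ⟸ NF-A ∧ NF-Q** (the type is `LegendreHalfTransfer.seedAwayFromP_of_dichotomy`'s, VERBATIM): for every class datum
`(p, χ mod m, k)` at the six leaf primes with a unit class factor there is an `m`-admissible imaginary quadratic `K₀` (every `q ∣ m` split,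
`d_{K₀}` odd `< −4`) with a Kronecker character and a unit field factor. Three-way split: off `D_p` the Eisenstein cusp seed
(`CuspGlue.cuspSeed_six_of_facts`); on `D_p` and genus-internal, `ℚ(√−p)` itself (§1); on `D_p` off the genus-internal pattern, LEAD g14's
no-exception glue on the two flipped-cusp rungs from the facts (`FlipRung.seedOffExc_of_flipRungAll_of_flipRungTwo`,
`FlipRung.flipRungAll_six_of_facts`, `FlipRung.flipRungTwo_six_of_facts_of_jmlTwoEight`, `FlipRung.jmlTwoEight_six_of_facts`). Nothing about BSD.
[cite: Cohen1975, Thm. 3.1] [cite: Katz1973, §1.6 Cor. 1.6.2] [cite: Raum2023RamanujanTypeII, Prop. 2.3 and Lemma 2.4] -/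
theorem seedAwayFromP_six_of_facts
    (hA : Literature.NumberTheory.ModularForms.Cohen1975.thm31_cohenSeries_mem_halfIntModularForms)
    (hQ : Literature.NumberTheory.ModularForms.Katz1973_qExpansionPrinciple_allCusps) :
    ∀ (p : ℕ) [Fact p.Prime] (m : ℕ) [NeZero m] (χ : DirichletCharacter ℚ_[p] m) (k : ℕ),
      (p = 7 ∨ p = 11 ∨ p = 19 ∨ p = 43 ∨ p = 67 ∨ p = 163) →
      m.Coprime p → χ.IsPrimitive → χ.IsQuadratic → (k = (p + 1) / 4 ∨ k = (3 * p - 1) / 4) →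
      2 ≤ k → k ≤ p - 2 → χ (-1) * (-1) ^ k = -1 →
      ¬ ‖((p - k : ℕ) : ℚ_[p])⁻¹ * generalizedBernoulli (p - k) χ‖ ≤ (p : ℝ)⁻¹ →
      ∃ (K : Type) (_ : Field K) (_ : NumberField K) (εK : DirichletCharacter ℚ_[p] (NumberField.discr K).natAbs),
        IsImaginaryQuadratic K ∧
        (∀ q : ℕ, q.Prime → q ∣ m → ((Ideal.span {(q : ℤ)}).primesOver (𝓞 K)).ncard = 2) ∧
        Odd (NumberField.discr K) ∧ NumberField.discr K < -4 ∧ IsKroneckerCharacterOf K εK ∧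
        ¬ ‖(k : ℚ_[p])⁻¹ * @generalizedBernoulli ℚ_[p] _ _
            (changeLevel (dvd_mul_right m (NumberField.discr K).natAbs) χ *
              changeLevel (dvd_mul_left (NumberField.discr K).natAbs m) εK).conductor ⟨conductor_ne_zero _⟩ k
            (changeLevel (dvd_mul_right m (NumberField.discr K).natAbs) χ *
              changeLevel (dvd_mul_left (NumberField.discr K).natAbs m) εK).primitiveCharacter‖ ≤ (p : ℝ)⁻¹ := by
  intro p _ m _ χ k hp6 hmp hχ hχq hk hk2 hkp hpar hreg
  by_cases hexc : ∃ ℓ : ℕ, ℓ.Prime ∧ ℓ ∣ m ∧ (ℓ % p = 1 ∨ ℓ % p = p - 1)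
  · by_cases hGI : (∀ q : ℕ, q.Prime → q ∣ m → q ≠ 2 → jacobiSym (-(p : ℤ)) q = 1) ∧ (2 ∣ m → p % 8 = 7)
    · exact seed_cmField_of_genusInternal hp6 m χ k hmp hχ hk hGI hreg
    · exact FlipRung.seedOffExc_of_flipRungAll_of_flipRungTwo (FlipRung.flipRungAll_six_of_facts hA hQ)
        (FlipRung.flipRungTwo_six_of_facts_of_jmlTwoEight hA hQ (FlipRung.jmlTwoEight_six_of_facts hA hQ))
        p m χ k hp6 hmp hχ hχq hk hk2 hkp hpar hGI hexc hreg
  · exact CuspGlue.cuspSeed_six_of_facts hA hQ p m χ k hp6 hmp hχ hχq hk hk2 hkp hpar hexc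

/-! ## §3 The two stubs of the line `legendre_half_transfer`, VERBATIM, from NF-A ∧ NF-Q -/

/-- **`LegendreHalfTransfer.stub_seedAwayFromP_offD` (card label DEVICE-M) ⟸ NF-A ∧ NF-Q** — its type VERBATIM. Off `D_p` this is the Eisenstein
cusp seed `CuspGlue.cuspSeed_six_of_facts` on the nose (the side condition `q ≠ 2` in the stub's `D_p` is vacuous at `p ≥ 7`), and the
REGULARITY binder of the stub is IDLE: off `D_p` every class datum — regular or not — has an `m`-admissible unit seed. Nothing about BSD.
[cite: Cohen1975, Thm. 3.1] [cite: Katz1973, §1.6 Cor. 1.6.2] -/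
theorem seedAwayFromP_offD_six_of_facts
    (hA : Literature.NumberTheory.ModularForms.Cohen1975.thm31_cohenSeries_mem_halfIntModularForms)
    (hQ : Literature.NumberTheory.ModularForms.Katz1973_qExpansionPrinciple_allCusps) :
    ∀ (p : ℕ) [Fact p.Prime] (m : ℕ) [NeZero m] (χ : DirichletCharacter ℚ_[p] m) (k : ℕ),
      (p = 7 ∨ p = 11 ∨ p = 19 ∨ p = 43 ∨ p = 67 ∨ p = 163) →
      m.Coprime p → χ.IsPrimitive → χ.IsQuadratic → (k = (p + 1) / 4 ∨ k = (3 * p - 1) / 4) →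
      2 ≤ k → k ≤ p - 2 → χ (-1) * (-1) ^ k = -1 →
      ¬ ‖((p - k : ℕ) : ℚ_[p])⁻¹ * generalizedBernoulli (p - k) χ‖ ≤ (p : ℝ)⁻¹ →
      ¬ (∃ q : ℕ, q.Prime ∧ q ∣ m ∧ q ≠ 2 ∧ (q % p = 1 ∨ q % p = p - 1)) →
      ∃ (K : Type) (_ : Field K) (_ : NumberField K) (εK : DirichletCharacter ℚ_[p] (NumberField.discr K).natAbs),
        IsImaginaryQuadratic K ∧
        (∀ q : ℕ, q.Prime → q ∣ m → ((Ideal.span {(q : ℤ)}).primesOver (𝓞 K)).ncard = 2) ∧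
        Odd (NumberField.discr K) ∧ NumberField.discr K < -4 ∧ IsKroneckerCharacterOf K εK ∧
        ¬ ‖(k : ℚ_[p])⁻¹ * @generalizedBernoulli ℚ_[p] _ _
            (changeLevel (dvd_mul_right m (NumberField.discr K).natAbs) χ *
              changeLevel (dvd_mul_left (NumberField.discr K).natAbs m) εK).conductor ⟨conductor_ne_zero _⟩ k
            (changeLevel (dvd_mul_right m (NumberField.discr K).natAbs) χ *
              changeLevel (dvd_mul_left (NumberField.discr K).natAbs m) εK).primitiveCharacter‖ ≤ (p : ℝ)⁻¹ := by
  intro p _ m _ χ k hp6 hmp hχ hχq hk hk2 hkp hpar _ hD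
  have h7 : 7 ≤ p := by rcases hp6 with h | h | h | h | h | h <;> omega
  refine CuspGlue.cuspSeed_six_of_facts hA hQ p m χ k hp6 hmp hχ hχq hk hk2 hkp hpar ?_
  rintro ⟨ℓ, hℓ, hℓm, hℓp⟩
  refine hD ⟨ℓ, hℓ, hℓm, ?_, hℓp⟩
  rintro rfl
  have h2p : 2 % p = 2 := Nat.mod_eq_of_lt (by omega)
  omega

/-- **`LegendreHalfTransfer.stub_seedAwayFromP_onD` (card label RESEARCH-S, «no device in hand, statement not in print») ⟸ NF-A ∧ NF-Q** —
its type VERBATIM; the special case `D_p(m)` of `seedAwayFromP_six_of_facts` (the device: on the genus-internal pattern `ℚ(√−p)` itself,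
otherwise the flipped-cusp rungs of the line of record). Nothing about BSD. [cite: Cohen1975, Thm. 3.1] [cite: Katz1973, §1.6 Cor. 1.6.2]
[cite: Raum2023RamanujanTypeII, Prop. 2.3 and Lemma 2.4] -/
theorem seedAwayFromP_onD_six_of_facts
    (hA : Literature.NumberTheory.ModularForms.Cohen1975.thm31_cohenSeries_mem_halfIntModularForms)
    (hQ : Literature.NumberTheory.ModularForms.Katz1973_qExpansionPrinciple_allCusps) :
    ∀ (p : ℕ) [Fact p.Prime] (m : ℕ) [NeZero m] (χ : DirichletCharacter ℚ_[p] m) (k : ℕ),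
      (p = 7 ∨ p = 11 ∨ p = 19 ∨ p = 43 ∨ p = 67 ∨ p = 163) →
      m.Coprime p → χ.IsPrimitive → χ.IsQuadratic → (k = (p + 1) / 4 ∨ k = (3 * p - 1) / 4) →
      2 ≤ k → k ≤ p - 2 → χ (-1) * (-1) ^ k = -1 →
      ¬ ‖((p - k : ℕ) : ℚ_[p])⁻¹ * generalizedBernoulli (p - k) χ‖ ≤ (p : ℝ)⁻¹ →
      (∃ q : ℕ, q.Prime ∧ q ∣ m ∧ q ≠ 2 ∧ (q % p = 1 ∨ q % p = p - 1)) →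
      ∃ (K : Type) (_ : Field K) (_ : NumberField K) (εK : DirichletCharacter ℚ_[p] (NumberField.discr K).natAbs),
        IsImaginaryQuadratic K ∧
        (∀ q : ℕ, q.Prime → q ∣ m → ((Ideal.span {(q : ℤ)}).primesOver (𝓞 K)).ncard = 2) ∧
        Odd (NumberField.discr K) ∧ NumberField.discr K < -4 ∧ IsKroneckerCharacterOf K εK ∧
        ¬ ‖(k : ℚ_[p])⁻¹ * @generalizedBernoulli ℚ_[p] _ _
            (changeLevel (dvd_mul_right m (NumberField.discr K).natAbs) χ *
              changeLevel (dvd_mul_left (NumberField.discr K).natAbs m) εK).conductor ⟨conductor_ne_zero _⟩ k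
            (changeLevel (dvd_mul_right m (NumberField.discr K).natAbs) χ *
              changeLevel (dvd_mul_left (NumberField.discr K).natAbs m) εK).primitiveCharacter‖ ≤ (p : ℝ)⁻¹ :=
  fun p _ m _ χ k hp6 hmp hχ hχq hk hk2 hkp hpar hreg _ =>
    seedAwayFromP_six_of_facts hA hQ p m χ k hp6 hmp hχ hχq hk hk2 hkp hpar hreg

end Summit.BirchSwinnertonDyer.BirchSwinnertonDyer.Theorems.PrintCFram.SeedAwayFromP

end
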